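import Summits.CriticalPhenomena.PercolationContinuityZ3.Theorems.PercNearOneGluingNoHeavyLowerTailSunflowerLeafLeafBase
import HarnessLib

/-!
# `NoHeavyLowerTail` (crux stmt-CriticalPhenomena-4575), abstract sunflower cubic: THE GENERAL LEAF-LEAF LEMMA REDUCES TO A
# SIX-NUMBER BLOCK INEQUALITY `FreeFour` (the base block `(e,g,f,h)` plus one FREE row resource and one FREE column resource)

Support file (seat `prim-ineq-prove-1` gen 67; `--supports stmt-CriticalPhenomena-4575`).  No `sorry`, no named facts; one definition
(`FreeFour`, a parametrised `Prop`, conjecture-shaped) used only as a hypothesis.  Memo: run/shared/lean/prim/prim-ineq-prove-1/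
FINDING-FREEFOUR-prove1-g67.md §1–§3.

SETTING (`…SunflowerLeafLeaf`, `…SunflowerLeafLeafBase`).  `A' = A ∪ {z₁,u open} ∪ ({z₁,z₂ open} ∪ {z₂,w open})` is the core of
`Γ + z₁z₂` for leaves `z₁ ~ u`, `z₂ ~ w`.  THE OBSERVATION (memo §1): for an ARBITRARY petal `W ⊇ A'` write `E = W|₀₀`, `Y = W|₁₀ ⊇ A ∪ {u open}`,
`X = W|₀₁ ⊇ A ∪ {w open}` for its sections at `(z₁,z₂) = (0,0), (1,0), (0,1)` (`W|₁₁` is everything).  Two petals meeting inside `A'`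
have `E`'s meeting inside `A`, `Y`'s inside `A ∪ {u open}`, `X`'s inside `A ∪ {w open}` — and NOTHING ELSE is required (the cross
conditions `E_i ∩ Y_j ⊆ A ∪ {u open}` follow from `E_i ⊆ Y_i`; `Y_i ∩ X_j` is free).  Since `Y ⊇ {u open}`, `μ(Y) = σ + (1−σ)·y` with
`y = μ(Y | u closed)` and `{Y_i | u closed}` a petal system of `A | u closed`; likewise `μ(X) = s + (1−s)x`, `{X_i | w closed}` a petal
system of `A | w closed`.  Hence `μ(W) ≤ κ + τ(1−t)(1−σ)·y + (1−τ)t(1−s)·x + (1−τ)(1−t)·μ(E)` (`κ = τt + τ(1−t)σ + (1−τ)ts`) with the links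
`y ≥ μ(E | u closed)`, `x ≥ μ(E | w closed)` and eleven Lemma-A budgets (`y`, `x`, and the nine `(u,w)`-faces of `E` as in `BaseFour`).
A BASE petal is the case of equality in both links, a `z₂`-diagonal petal (`…SunflowerLeafLeafDiagonal`) equality in the `x`-link.  So THE
WHOLE LEAF-LEAF LEMMA IS THE SIX-NUMBER INEQUALITY `FreeFour` below.  Numerics (memo §3): no violation found (structured adversary and
vertex climber, small and large coins); keeping only the block budget of `E` (no cells/rows/columns) is false by a wide margin.
* `FreeFour σ s τ t α₀₀ α₀₁ α₁₀ α₁₁` — the statement; `baseFour_of_freeFour` — it contains `BaseFour`;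
* **`leafLeaf_of_freeFour`** (fixed `p`) — `FreeFour` at `(p_u, p_w, p_{z₁}, p_{z₂}; α)` and safety at `p` of the nine `(u,w)`-minors
  of `A` give Lemma A `∏ μ(V_i) ≤ μ(A')^(n−1)` for EVERY family of up-sets meeting pairwise inside `A'` (no diagonality, no positivity);
* `leafLeaf_of_freeFour_aSafe`, `leafLeaf_of_freeFour_graph` — the same from A-safety of `A` / for `Γ₀ + z₁u + z₂w + z₁z₂`.
-/

noncomputable section

namespace Summit.CriticalPhenomena.PercolationContinuityZ3.Theorems.SunflowerPartition

namespace SafeCalc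

open MeasureTheory Finset
open Literature.Probability.LatticeModels Literature.Probability.Percolation

namespace LeafLeafZ

/-- **`FreeFour` (statement): the six-number block inequality equivalent to the leaf-leaf lemma.**  Coins `σ = p_u`, `s = p_w`,
`τ = p_{z₁}`, `t = p_{z₂}`; floors `α_ab = μ(A | u = a, w = b)`; a petal is a cell quadruple `(e,g,f,h)` above the floors with the
up-set links `e ≤ g ≤ h`, `e ≤ f ≤ h ≤ 1` (the sections of `E = W|₀₀` over `(u,w)`), a row resource `y ∈ [(1−s)e+sg, 1]`
(`= μ(W|₁₀ | u closed)`) and a column resource `x ∈ [(1−σ)e+σf, 1]` (`= μ(W|₀₁ | w closed)`); budgets = Lemma A (product form) for the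
four cells, two rows, two columns and the block of `E`, for `y` (floor `(1−s)α₀₀+sα₀₁`) and for `x` (floor `(1−σ)α₀₀+σα₁₀`).  CLAIM:
`∏ (κ + τ(1−t)(1−σ)y_j + (1−τ)t(1−s)x_j + (1−τ)(1−t)·block_j) ≤ (value at the floors)^(n−1)`, `κ = τt + τ(1−t)σ + (1−τ)ts`.
Open; numerically supported (memo §3); implies the leaf-leaf lemma for every family (`leafLeaf_of_freeFour`).
[conjecture-shaped hypothesis, this work] -/
def FreeFour (σ s τ t α00 α01 α10 α11 : ℝ) : Prop :=
  ∀ (n : ℕ) (e g f h y x : Fin n → ℝ),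
    (∀ j, α00 ≤ e j) → (∀ j, α01 ≤ g j) → (∀ j, α10 ≤ f j) → (∀ j, α11 ≤ h j) → (∀ j, h j ≤ 1) →
    (∀ j, e j ≤ g j) → (∀ j, e j ≤ f j) → (∀ j, g j ≤ h j) → (∀ j, f j ≤ h j) →
    (∀ j, (1 - s) * e j + s * g j ≤ y j) → (∀ j, y j ≤ 1) → (∀ j, (1 - σ) * e j + σ * f j ≤ x j) → (∀ j, x j ≤ 1) →
    ∏ j, e j ≤ α00 ^ (n - 1) → ∏ j, g j ≤ α01 ^ (n - 1) → ∏ j, f j ≤ α10 ^ (n - 1) → ∏ j, h j ≤ α11 ^ (n - 1) →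
    ∏ j, ((1 - s) * e j + s * g j) ≤ ((1 - s) * α00 + s * α01) ^ (n - 1) →
    ∏ j, ((1 - s) * f j + s * h j) ≤ ((1 - s) * α10 + s * α11) ^ (n - 1) →
    ∏ j, ((1 - σ) * e j + σ * f j) ≤ ((1 - σ) * α00 + σ * α10) ^ (n - 1) →
    ∏ j, ((1 - σ) * g j + σ * h j) ≤ ((1 - σ) * α01 + σ * α11) ^ (n - 1) →
    ∏ j, ((1 - σ) * ((1 - s) * e j + s * g j) + σ * ((1 - s) * f j + s * h j)) ≤
      ((1 - σ) * ((1 - s) * α00 + s * α01) + σ * ((1 - s) * α10 + s * α11)) ^ (n - 1) →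
    ∏ j, y j ≤ ((1 - s) * α00 + s * α01) ^ (n - 1) →
    ∏ j, x j ≤ ((1 - σ) * α00 + σ * α10) ^ (n - 1) →
    ∏ j, (τ * t + τ * (1 - t) * σ + (1 - τ) * t * s + τ * (1 - t) * (1 - σ) * y j + (1 - τ) * t * (1 - s) * x j +
        (1 - τ) * (1 - t) * ((1 - σ) * ((1 - s) * e j + s * g j) + σ * ((1 - s) * f j + s * h j))) ≤
      (τ * t + τ * (1 - t) * σ + (1 - τ) * t * s + τ * (1 - t) * (1 - σ) * ((1 - s) * α00 + s * α01) +
        (1 - τ) * t * (1 - s) * ((1 - σ) * α00 + σ * α10) +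
        (1 - τ) * (1 - t) * ((1 - σ) * ((1 - s) * α00 + s * α01) + σ * ((1 - s) * α10 + s * α11))) ^ (n - 1)

/-- **`FreeFour` contains `BaseFour`** (take the row and column resources at their links; coins in `[0,1]`). [this work] -/
theorem baseFour_of_freeFour {σ s τ t α00 α01 α10 α11 : ℝ} (hσ0 : 0 ≤ σ) (hσ1 : σ ≤ 1) (hs0 : 0 ≤ s) (hs1 : s ≤ 1)
    (hF : FreeFour σ s τ t α00 α01 α10 α11) : BaseFour σ s τ t α00 α01 α10 α11 := by
  intro n e g f h he hg hf hh hh1 leg lef lgh lfh Be Bg Bf Bh Br0 Br1 Bc0 Bc1 BA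
  have hy1 : ∀ j, (1 - s) * e j + s * g j ≤ 1 := fun j => by
    have he1 : e j ≤ 1 := (leg j).trans ((lgh j).trans (hh1 j))
    have hg1 : g j ≤ 1 := (lgh j).trans (hh1 j)
    have k1 := mul_le_mul_of_nonneg_left he1 (sub_nonneg.2 hs1)
    have k2 := mul_le_mul_of_nonneg_left hg1 hs0
    linarith only [k1, k2]
  have hx1 : ∀ j, (1 - σ) * e j + σ * f j ≤ 1 := fun j => by
    have he1 : e j ≤ 1 := (lef j).trans ((lfh j).trans (hh1 j))
    have hf1 : f j ≤ 1 := (lfh j).trans (hh1 j)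
    have k1 := mul_le_mul_of_nonneg_left he1 (sub_nonneg.2 hσ1)
    have k2 := mul_le_mul_of_nonneg_left hf1 hσ0
    linarith only [k1, k2]
  have key := hF n e g f h (fun j => (1 - s) * e j + s * g j) (fun j => (1 - σ) * e j + σ * f j) he hg hf hh hh1 leg lef lgh lfh
    (fun j => le_rfl) hy1 (fun j => le_rfl) hx1 Be Bg Bf Bh Br0 Br1 Bc0 Bc1 BA Br0 Bc0
  refine le_of_eq_of_le (prod_congr rfl fun j _ => by ring) (key.trans (le_of_eq ?_))
  ring

end LeafLeafZ

open RelLemmaA UnionEdge LeafLeafZ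

variable {ι : Type*} [Fintype ι] [DecidableEq ι] (p : ι → unitInterval)

/-- **THE LEAF-LEAF LEMMA FROM `FreeFour` (fixed `p`), every family.**  `A` an up-set not depending on `z₁, z₂`; `z₁, z₂, u, w`
pairwise distinct; the nine minors/faces of `A` over `(u,w)` safe at `p`; `FreeFour` at the coins `(p_u, p_w, p_{z₁}, p_{z₂})` and the
floors of `A`.  Then EVERY family of up-sets `V_i` meeting pairwise inside `A' = A ∪ {z₁,u open} ∪ ({z₁,z₂ open} ∪ {z₂,w open})`
satisfies `∏ μ(V_i) ≤ μ(A')^(n−1)`.  Proof: memo §1 — section `W_i = V_i ∪ A'` at `(z₁,z₂)`, then the `(1,0)`-section at `u`, the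
`(0,1)`-section at `w`, the `(0,0)`-section at `(u,w)`. [this work] -/
theorem leafLeaf_of_freeFour {z₁ z₂ u w : ι} (h12 : z₁ ≠ z₂) (h1u : z₁ ≠ u) (h1w : z₁ ≠ w) (h2u : z₂ ≠ u) (h2w : z₂ ≠ w)
    (huw : u ≠ w) {A : Set (Set ι)} (hd₁ : DeterminedBy A (↑({z₁} : Finset ι) : Set ι)ᶜ)
    (hd₂ : DeterminedBy A (↑({z₂} : Finset ι) : Set ι)ᶜ) (hA : IsUpperSet A)
    (hS00 : Safe p (secOff w (secOff u A))) (hS01 : Safe p (secOn w (secOff u A))) (hS10 : Safe p (secOff w (secOn u A)))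
    (hS11 : Safe p (secOn w (secOn u A))) (hSu0 : Safe p (secOff u A)) (hSu1 : Safe p (secOn u A)) (hSw0 : Safe p (secOff w A))
    (hSw1 : Safe p (secOn w A)) (hAA : Safe p A)
    (hF : FreeFour (p u) (p w) (p z₁) (p z₂)
      ((prodBernoulli p).real (secOff w (secOff u A))) ((prodBernoulli p).real (secOn w (secOff u A)))
      ((prodBernoulli p).real (secOff w (secOn u A))) ((prodBernoulli p).real (secOn w (secOn u A))))
    {n : ℕ} (V : Fin n → Set (Set ι)) (hV : ∀ i, IsUpperSet (V i))
    (hcap : ∀ i j, i ≠ j → V i ∩ V j ⊆ A ∪ pairOpen z₁ u ∪ (pairOpen z₁ z₂ ∪ pairOpen z₂ w)) :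
    ∏ i, (prodBernoulli p).real (V i) ≤
      (prodBernoulli p).real (A ∪ pairOpen z₁ u ∪ (pairOpen z₁ z₂ ∪ pairOpen z₂ w)) ^ (n - 1) := by
  classical
  rcases Nat.eq_zero_or_pos n with rfl | hn
  · simp
  set A' : Set (Set ι) := A ∪ pairOpen z₁ u ∪ (pairOpen z₁ z₂ ∪ pairOpen z₂ w) with hA'def
  have hA'up : IsUpperSet A' :=
    (hA.union (isUpperSet_pairOpen z₁ u)).union ((isUpperSet_pairOpen z₁ z₂).union (isUpperSet_pairOpen z₂ w))
  -- coins
  set τ : ℝ := ((p z₁ : unitInterval) : ℝ) with hτ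
  set t : ℝ := ((p z₂ : unitInterval) : ℝ) with ht
  set σ : ℝ := ((p u : unitInterval) : ℝ) with hσ
  set s : ℝ := ((p w : unitInterval) : ℝ) with hs
  have hτ0 : 0 ≤ τ := (p z₁).2.1
  have hτ1 : τ ≤ 1 := (p z₁).2.2
  have ht0 : 0 ≤ t := (p z₂).2.1
  have ht1 : t ≤ 1 := (p z₂).2.2
  have hσ0 : 0 ≤ σ := (p u).2.1
  have hσ1 : σ ≤ 1 := (p u).2.2
  have hs0 : 0 ≤ s := (p w).2.1
  have hs1 : s ≤ 1 := (p w).2.2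
  -- floors
  set α00 : ℝ := (prodBernoulli p).real (secOff w (secOff u A)) with hα00
  set α01 : ℝ := (prodBernoulli p).real (secOn w (secOff u A)) with hα01
  set α10 : ℝ := (prodBernoulli p).real (secOff w (secOn u A)) with hα10
  set α11 : ℝ := (prodBernoulli p).real (secOn w (secOn u A)) with hα11
  have hb0 : (prodBernoulli p).real (secOff u A) = (1 - s) * α00 + s * α01 := by
    rw [real_eq_secOn_secOff p w]; ring
  have hb1 : (prodBernoulli p).real (secOn u A) = (1 - s) * α10 + s * α11 := by
    rw [real_eq_secOn_secOff p w]; ring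
  have hc0 : (prodBernoulli p).real (secOff w A) = (1 - σ) * α00 + σ * α10 := by
    rw [real_eq_secOn_secOff p u, secOn_secOff_comm huw, secOff_secOff_comm u w]; ring
  have hc1 : (prodBernoulli p).real (secOn w A) = (1 - σ) * α01 + σ * α11 := by
    rw [real_eq_secOn_secOff p u, secOn_secOn_comm u w, ← secOn_secOff_comm huw.symm]; ring
  have hAval : (prodBernoulli p).real A = (1 - σ) * ((1 - s) * α00 + s * α01) + σ * ((1 - s) * α10 + s * α11) := by
    rw [real_eq_secOn_secOff p u A, hb0, hb1]; ring
  -- sections of `A` and `A'` at the leaves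
  have hA_on₁ : secOn z₁ A = A := secOn_eq_self_of_determinedBy hd₁
  have hA_off₁ : secOff z₁ A = A := secOff_eq_self_of_determinedBy hd₁
  have hA'_on : secOn z₂ A' = A ∪ pairOpen z₁ u ∪ ({ω | z₁ ∈ ω} ∪ {ω | w ∈ ω}) := by
    rw [hA'def, secOn_union, secOn_union, secOn_union, secOn_eq_self_of_determinedBy hd₂, secOn_pairOpen_of_ne h12 h2u.symm,
      secOn_pairOpen_right h12, secOn_pairOpen_left h2w]
  have hA'_off : secOff z₂ A' = A ∪ pairOpen z₁ u := by
    rw [hA'def, secOff_union, secOff_union, secOff_union, secOff_eq_self_of_determinedBy hd₂,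
      secOff_pairOpen_of_ne h12 h2u.symm, secOff_pairOpen_right, secOff_pairOpen_left, Set.union_empty, Set.union_empty]
  have hA'_10 : secOn z₁ (secOff z₂ A') = A ∪ {ω | u ∈ ω} := by
    rw [hA'_off, secOn_union, hA_on₁, secOn_pairOpen_left h1u]
  have hA'_01 : secOff z₁ (secOn z₂ A') = A ∪ {ω | w ∈ ω} := by
    rw [hA'_on, secOff_union, secOff_union, secOff_union, hA_off₁, secOff_pairOpen_left, secOff_setOf_mem_self,
      secOff_setOf_mem_of_ne h1w.symm, Set.union_empty, Set.empty_union]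
  have hA'_00 : secOff z₁ (secOff z₂ A') = A := by
    rw [hA'_off, secOff_union, hA_off₁, secOff_pairOpen_left, Set.union_empty]
  -- enlarge the petals and section them at the leaves
  set W : Fin n → Set (Set ι) := fun i => V i ∪ A' with hW
  have hWup : ∀ i, IsUpperSet (W i) := fun i => (hV i).union hA'up
  have hWA : ∀ i, A' ⊆ W i := fun i => Set.subset_union_right
  have hWcap : ∀ i j, i ≠ j → W i ∩ W j ⊆ A' := by
    intro i j hij ω hω
    rcases hω with ⟨h1 | h1, h2 | h2⟩
    · exact hcap i j hij ⟨h1, h2⟩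
    exacts [h2, h1, h1]
  have hmono : ∀ i, (prodBernoulli p).real (V i) ≤ (prodBernoulli p).real (W i) := fun i => measureReal_mono Set.subset_union_left
  set E : Fin n → Set (Set ι) := fun i => secOff z₁ (secOff z₂ (W i)) with hE
  set Y : Fin n → Set (Set ι) := fun i => secOn z₁ (secOff z₂ (W i)) with hY
  set X : Fin n → Set (Set ι) := fun i => secOff z₁ (secOn z₂ (W i)) with hX
  set Yr : Fin n → Set (Set ι) := fun i => secOff u (Y i) with hYr
  set Xr : Fin n → Set (Set ι) := fun i => secOff w (X i) with hXr
  have hEup : ∀ i, IsUpperSet (E i) := fun i => isUpperSet_secOff z₁ (isUpperSet_secOff z₂ (hWup i))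
  have hYup : ∀ i, IsUpperSet (Y i) := fun i => isUpperSet_secOn z₁ (isUpperSet_secOff z₂ (hWup i))
  have hXup : ∀ i, IsUpperSet (X i) := fun i => isUpperSet_secOff z₁ (isUpperSet_secOn z₂ (hWup i))
  have hYrup : ∀ i, IsUpperSet (Yr i) := fun i => isUpperSet_secOff u (hYup i)
  have hXrup : ∀ i, IsUpperSet (Xr i) := fun i => isUpperSet_secOff w (hXup i)
  have hEA : ∀ i, A ⊆ E i := fun i => by
    rw [← hA'_00]; exact secOff_mono z₁ (secOff_mono z₂ (hWA i))
  have hEY : ∀ i, E i ⊆ Y i := fun i => secOff_subset_secOn z₁ (isUpperSet_secOff z₂ (hWup i))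
  have hEX : ∀ i, E i ⊆ X i := fun i => secOff_mono z₁ (secOff_subset_secOn z₂ (hWup i))
  have hEcap : ∀ i j, i ≠ j → E i ∩ E j ⊆ A := fun i j hij => by
    simp only [hE]; rw [← secOff_inter, ← secOff_inter, ← hA'_00]; exact secOff_mono z₁ (secOff_mono z₂ (hWcap i j hij))
  have hYcap : ∀ i j, i ≠ j → Y i ∩ Y j ⊆ A ∪ {ω | u ∈ ω} := fun i j hij => by
    simp only [hY]; rw [← secOn_inter, ← secOff_inter, ← hA'_10]; exact secOn_mono z₁ (secOff_mono z₂ (hWcap i j hij))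
  have hXcap : ∀ i j, i ≠ j → X i ∩ X j ⊆ A ∪ {ω | w ∈ ω} := fun i j hij => by
    simp only [hX]; rw [← secOff_inter, ← secOn_inter, ← hA'_01]; exact secOff_mono z₁ (secOn_mono z₂ (hWcap i j hij))
  have hYrcap : ∀ i j, i ≠ j → Yr i ∩ Yr j ⊆ secOff u A := fun i j hij => by
    simp only [hYr]; rw [← secOff_inter]; refine (secOff_mono u (hYcap i j hij)).trans ?_
    rw [secOff_union, secOff_setOf_mem_self, Set.union_empty]
  have hXrcap : ∀ i j, i ≠ j → Xr i ∩ Xr j ⊆ secOff w A := fun i j hij => by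
    simp only [hXr]; rw [← secOff_inter]; refine (secOff_mono w (hXcap i j hij)).trans ?_
    rw [secOff_union, secOff_setOf_mem_self, Set.union_empty]
  -- cell data of petal `i`
  set ce : Fin n → ℝ := fun i => (prodBernoulli p).real (secOff w (secOff u (E i))) with hce
  set cg : Fin n → ℝ := fun i => (prodBernoulli p).real (secOn w (secOff u (E i))) with hcg
  set cf : Fin n → ℝ := fun i => (prodBernoulli p).real (secOff w (secOn u (E i))) with hcf
  set ch : Fin n → ℝ := fun i => (prodBernoulli p).real (secOn w (secOn u (E i))) with hch
  set y : Fin n → ℝ := fun i => (prodBernoulli p).real (Yr i) with hy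
  set x : Fin n → ℝ := fun i => (prodBernoulli p).real (Xr i) with hx
  have fe : ∀ i, α00 ≤ ce i := fun i => measureReal_mono (secOff_mono w (secOff_mono u (hEA i)))
  have fg : ∀ i, α01 ≤ cg i := fun i => measureReal_mono (secOn_mono w (secOff_mono u (hEA i)))
  have ff : ∀ i, α10 ≤ cf i := fun i => measureReal_mono (secOff_mono w (secOn_mono u (hEA i)))
  have fh : ∀ i, α11 ≤ ch i := fun i => measureReal_mono (secOn_mono w (secOn_mono u (hEA i)))
  have ch1 : ∀ i, ch i ≤ 1 := fun i => measureReal_le_one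
  have y1 : ∀ i, y i ≤ 1 := fun i => measureReal_le_one
  have x1 : ∀ i, x i ≤ 1 := fun i => measureReal_le_one
  have leg : ∀ i, ce i ≤ cg i := fun i => measureReal_mono (secOff_subset_secOn w (isUpperSet_secOff u (hEup i)))
  have lef : ∀ i, ce i ≤ cf i := fun i => by
    simp only [hce, hcf]; rw [secOff_secOff_comm w u, ← secOn_secOff_comm huw]
    exact measureReal_mono (secOff_subset_secOn u (isUpperSet_secOff w (hEup i)))
  have lgh : ∀ i, cg i ≤ ch i := fun i => by
    simp only [hcg, hch]; rw [secOn_secOff_comm huw.symm, secOn_secOn_comm w u]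
    exact measureReal_mono (secOff_subset_secOn u (isUpperSet_secOn w (hEup i)))
  have lfh : ∀ i, cf i ≤ ch i := fun i => measureReal_mono (secOff_subset_secOn w (isUpperSet_secOn u (hEup i)))
  -- row / column / block values
  have hrow0 : ∀ i, (prodBernoulli p).real (secOff u (E i)) = (1 - s) * ce i + s * cg i := fun i => by
    rw [real_eq_secOn_secOff p w]; ring
  have hrow1 : ∀ i, (prodBernoulli p).real (secOn u (E i)) = (1 - s) * cf i + s * ch i := fun i => by
    rw [real_eq_secOn_secOff p w]; ring
  have hcol0 : ∀ i, (prodBernoulli p).real (secOff w (E i)) = (1 - σ) * ce i + σ * cf i := fun i => by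
    rw [real_eq_secOn_secOff p u, secOn_secOff_comm huw, secOff_secOff_comm u w]; ring
  have hcol1 : ∀ i, (prodBernoulli p).real (secOn w (E i)) = (1 - σ) * cg i + σ * ch i := fun i => by
    rw [real_eq_secOn_secOff p u, secOn_secOn_comm u w, ← secOn_secOff_comm huw.symm]; ring
  have hblk : ∀ i, (prodBernoulli p).real (E i) = (1 - σ) * ((1 - s) * ce i + s * cg i) + σ * ((1 - s) * cf i + s * ch i) :=
    fun i => by rw [real_eq_secOn_secOff p u, hrow0, hrow1]; ring
  -- links of the free resources
  have ly : ∀ i, (1 - s) * ce i + s * cg i ≤ y i := fun i => by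
    rw [← hrow0]; exact measureReal_mono (secOff_mono u (hEY i))
  have lx : ∀ i, (1 - σ) * ce i + σ * cf i ≤ x i := fun i => by
    rw [← hcol0]; exact measureReal_mono (secOff_mono w (hEX i))
  -- the eleven budgets
  have cap2 : ∀ (op₁ op₂ : Set (Set ι) → Set (Set ι)), (∀ X Y, op₁ (X ∩ Y) = op₁ X ∩ op₁ Y) → (∀ X Y, op₂ (X ∩ Y) = op₂ X ∩ op₂ Y) →
      (∀ X Y, X ⊆ Y → op₁ X ⊆ op₁ Y) → (∀ X Y, X ⊆ Y → op₂ X ⊆ op₂ Y) →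
      ∀ i j, i ≠ j → op₁ (op₂ (E i)) ∩ op₁ (op₂ (E j)) ⊆ op₁ (op₂ A) := by
    intro op₁ op₂ h₁ h₂ m₁ m₂ i j hij
    rw [← h₁, ← h₂]; exact m₁ _ _ (m₂ _ _ (hEcap i j hij))
  have cap1 : ∀ (op : Set (Set ι) → Set (Set ι)), (∀ X Y, op (X ∩ Y) = op X ∩ op Y) → (∀ X Y, X ⊆ Y → op X ⊆ op Y) →
      ∀ i j, i ≠ j → op (E i) ∩ op (E j) ⊆ op A := by
    intro op h₁ m₁ i j hij
    rw [← h₁]; exact m₁ _ _ (hEcap i j hij)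
  have Be : ∏ i, ce i ≤ α00 ^ (n - 1) :=
    hS00 n _ (fun i => isUpperSet_secOff w (isUpperSet_secOff u (hEup i)))
      (cap2 (secOff w) (secOff u) (secOff_inter w) (secOff_inter u) (fun _ _ => secOff_mono w) (fun _ _ => secOff_mono u))
  have Bg : ∏ i, cg i ≤ α01 ^ (n - 1) :=
    hS01 n _ (fun i => isUpperSet_secOn w (isUpperSet_secOff u (hEup i)))
      (cap2 (secOn w) (secOff u) (secOn_inter w) (secOff_inter u) (fun _ _ => secOn_mono w) (fun _ _ => secOff_mono u))
  have Bf : ∏ i, cf i ≤ α10 ^ (n - 1) :=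
    hS10 n _ (fun i => isUpperSet_secOff w (isUpperSet_secOn u (hEup i)))
      (cap2 (secOff w) (secOn u) (secOff_inter w) (secOn_inter u) (fun _ _ => secOff_mono w) (fun _ _ => secOn_mono u))
  have Bh : ∏ i, ch i ≤ α11 ^ (n - 1) :=
    hS11 n _ (fun i => isUpperSet_secOn w (isUpperSet_secOn u (hEup i)))
      (cap2 (secOn w) (secOn u) (secOn_inter w) (secOn_inter u) (fun _ _ => secOn_mono w) (fun _ _ => secOn_mono u))
  have Br0 : ∏ i, ((1 - s) * ce i + s * cg i) ≤ ((1 - s) * α00 + s * α01) ^ (n - 1) := by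
    rw [← hb0]
    refine le_of_eq_of_le (prod_congr rfl fun i _ => (hrow0 i).symm) ?_
    exact hSu0 n _ (fun i => isUpperSet_secOff u (hEup i)) (cap1 (secOff u) (secOff_inter u) (fun _ _ => secOff_mono u))
  have Br1 : ∏ i, ((1 - s) * cf i + s * ch i) ≤ ((1 - s) * α10 + s * α11) ^ (n - 1) := by
    rw [← hb1]
    refine le_of_eq_of_le (prod_congr rfl fun i _ => (hrow1 i).symm) ?_
    exact hSu1 n _ (fun i => isUpperSet_secOn u (hEup i)) (cap1 (secOn u) (secOn_inter u) (fun _ _ => secOn_mono u))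
  have Bc0 : ∏ i, ((1 - σ) * ce i + σ * cf i) ≤ ((1 - σ) * α00 + σ * α10) ^ (n - 1) := by
    rw [← hc0]
    refine le_of_eq_of_le (prod_congr rfl fun i _ => (hcol0 i).symm) ?_
    exact hSw0 n _ (fun i => isUpperSet_secOff w (hEup i)) (cap1 (secOff w) (secOff_inter w) (fun _ _ => secOff_mono w))
  have Bc1 : ∏ i, ((1 - σ) * cg i + σ * ch i) ≤ ((1 - σ) * α01 + σ * α11) ^ (n - 1) := by
    rw [← hc1]
    refine le_of_eq_of_le (prod_congr rfl fun i _ => (hcol1 i).symm) ?_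
    exact hSw1 n _ (fun i => isUpperSet_secOn w (hEup i)) (cap1 (secOn w) (secOn_inter w) (fun _ _ => secOn_mono w))
  have BA : ∏ i, ((1 - σ) * ((1 - s) * ce i + s * cg i) + σ * ((1 - s) * cf i + s * ch i)) ≤
      ((1 - σ) * ((1 - s) * α00 + s * α01) + σ * ((1 - s) * α10 + s * α11)) ^ (n - 1) := by
    rw [← hAval]
    refine le_of_eq_of_le (prod_congr rfl fun i _ => (hblk i).symm) ?_
    exact hAA n E hEup hEcap
  have By : ∏ i, y i ≤ ((1 - s) * α00 + s * α01) ^ (n - 1) := by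
    rw [← hb0]; exact hSu0 n Yr hYrup hYrcap
  have Bx : ∏ i, x i ≤ ((1 - σ) * α00 + σ * α10) ^ (n - 1) := by
    rw [← hc0]; exact hSw0 n Xr hXrup hXrcap
  -- the value of a petal
  have hval : ∀ i, (prodBernoulli p).real (W i) ≤ τ * t + τ * (1 - t) * σ + (1 - τ) * t * s + τ * (1 - t) * (1 - σ) * y i +
      (1 - τ) * t * (1 - s) * x i + (1 - τ) * (1 - t) * ((1 - σ) * ((1 - s) * ce i + s * cg i) + σ * ((1 - s) * cf i + s * ch i)) := by
    intro i
    have e11 : (prodBernoulli p).real (secOn z₁ (secOn z₂ (W i))) ≤ 1 := measureReal_le_one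
    have eY : (prodBernoulli p).real (Y i) ≤ σ + (1 - σ) * y i := by
      have h1 : (prodBernoulli p).real (secOn u (Y i)) ≤ 1 := measureReal_le_one
      have h2 : (prodBernoulli p).real (Y i) = σ * (prodBernoulli p).real (secOn u (Y i)) + (1 - σ) * y i :=
        real_eq_secOn_secOff p u (Y i)
      rw [h2]
      have k1 := mul_le_mul_of_nonneg_left h1 hσ0
      linarith only [k1]
    have eX : (prodBernoulli p).real (X i) ≤ s + (1 - s) * x i := by
      have h1 : (prodBernoulli p).real (secOn w (X i)) ≤ 1 := measureReal_le_one
      have h2 : (prodBernoulli p).real (X i) = s * (prodBernoulli p).real (secOn w (X i)) + (1 - s) * x i :=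
        real_eq_secOn_secOff p w (X i)
      rw [h2]
      have k1 := mul_le_mul_of_nonneg_left h1 hs0
      linarith only [k1]
    have eE : (prodBernoulli p).real (E i) = (1 - σ) * ((1 - s) * ce i + s * cg i) + σ * ((1 - s) * cf i + s * ch i) := hblk i
    have hOn : (prodBernoulli p).real (secOn z₂ (W i)) ≤ τ * 1 + (1 - τ) * (s + (1 - s) * x i) := by
      have h2 : (prodBernoulli p).real (secOn z₂ (W i)) =
          τ * (prodBernoulli p).real (secOn z₁ (secOn z₂ (W i))) + (1 - τ) * (prodBernoulli p).real (X i) :=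
        real_eq_secOn_secOff p z₁ (secOn z₂ (W i))
      rw [h2]
      have k1 := mul_le_mul_of_nonneg_left e11 hτ0
      have k2 := mul_le_mul_of_nonneg_left eX (sub_nonneg.2 hτ1)
      linarith only [k1, k2]
    have hOff : (prodBernoulli p).real (secOff z₂ (W i)) ≤ τ * (σ + (1 - σ) * y i) +
        (1 - τ) * ((1 - σ) * ((1 - s) * ce i + s * cg i) + σ * ((1 - s) * cf i + s * ch i)) := by
      have h2 : (prodBernoulli p).real (secOff z₂ (W i)) =
          τ * (prodBernoulli p).real (Y i) + (1 - τ) * (prodBernoulli p).real (E i) :=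
        real_eq_secOn_secOff p z₁ (secOff z₂ (W i))
      rw [h2, eE]
      have k1 := mul_le_mul_of_nonneg_left eY hτ0
      linarith only [k1]
    have h3 : (prodBernoulli p).real (W i) =
        t * (prodBernoulli p).real (secOn z₂ (W i)) + (1 - t) * (prodBernoulli p).real (secOff z₂ (W i)) :=
      real_eq_secOn_secOff p z₂ (W i)
    rw [h3]
    have k1 := mul_le_mul_of_nonneg_left hOn ht0
    have k2 := mul_le_mul_of_nonneg_left hOff (sub_nonneg.2 ht1)
    linarith only [k1, k2]
  -- the value of the core
  have hA'val : (prodBernoulli p).real A' = τ * t + τ * (1 - t) * σ + (1 - τ) * t * s +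
      τ * (1 - t) * (1 - σ) * ((1 - s) * α00 + s * α01) + (1 - τ) * t * (1 - s) * ((1 - σ) * α00 + σ * α10) +
      (1 - τ) * (1 - t) * ((1 - σ) * ((1 - s) * α00 + s * α01) + σ * ((1 - s) * α10 + s * α11)) := by
    have e10 : (prodBernoulli p).real (secOn z₁ (secOff z₂ A')) = σ + (1 - σ) * ((1 - s) * α00 + s * α01) := by
      rw [hA'_10, real_eq_secOn_secOff p u, secOn_union, secOn_setOf_mem_self, Set.union_univ, secOff_union, secOff_setOf_mem_self,
        Set.union_empty, probReal_univ, hb0]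
      ring
    have e01 : (prodBernoulli p).real (secOff z₁ (secOn z₂ A')) = s + (1 - s) * ((1 - σ) * α00 + σ * α10) := by
      rw [hA'_01, real_eq_secOn_secOff p w, secOn_union, secOn_setOf_mem_self, Set.union_univ, secOff_union, secOff_setOf_mem_self,
        Set.union_empty, probReal_univ, hc0]
      ring
    have e11 : (prodBernoulli p).real (secOn z₁ (secOn z₂ A')) = 1 := by
      have h1 : secOn z₁ (secOn z₂ A') = Set.univ := by
        rw [hA'_on, secOn_union, secOn_union, secOn_union, secOn_setOf_mem_self]; simp
      rw [h1, probReal_univ]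
    rw [real_eq_secOn_secOff p z₂ A', real_eq_secOn_secOff p z₁ (secOn z₂ A'), real_eq_secOn_secOff p z₁ (secOff z₂ A'),
      e11, e10, e01, hA'_00, hAval]
    ring
  -- assemble
  have key := hF n ce cg cf ch y x fe fg ff fh ch1 leg lef lgh lfh ly y1 lx x1 Be Bg Bf Bh Br0 Br1 Bc0 Bc1 BA By Bx
  rw [hA'val]
  calc ∏ i, (prodBernoulli p).real (V i) ≤ ∏ i, (prodBernoulli p).real (W i) :=
        prod_le_prod (fun i _ => measureReal_nonneg) fun i _ => hmono i
    _ ≤ _ := (prod_le_prod (fun i _ => measureReal_nonneg) fun i _ => hval i).trans key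

/-- **The leaf-leaf lemma from `FreeFour` and A-safety of `A`**, every family (the nine minors of an A-safe core are safe at every `p`:
`aSafe_delMinor`, `aSafe_conMinor`). [this work] -/
theorem leafLeaf_of_freeFour_aSafe {z₁ z₂ u w : ι} (h12 : z₁ ≠ z₂) (h1u : z₁ ≠ u) (h1w : z₁ ≠ w) (h2u : z₂ ≠ u)
    (h2w : z₂ ≠ w) (huw : u ≠ w) {A : Set (Set ι)} (hd₁ : DeterminedBy A (↑({z₁} : Finset ι) : Set ι)ᶜ)
    (hd₂ : DeterminedBy A (↑({z₂} : Finset ι) : Set ι)ᶜ) (hA : IsUpperSet A) (hsafe : ∀ q, Safe q A)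
    (hF : FreeFour (p u) (p w) (p z₁) (p z₂)
      ((prodBernoulli p).real (secOff w (secOff u A))) ((prodBernoulli p).real (secOn w (secOff u A)))
      ((prodBernoulli p).real (secOff w (secOn u A))) ((prodBernoulli p).real (secOn w (secOn u A))))
    {n : ℕ} (V : Fin n → Set (Set ι)) (hV : ∀ i, IsUpperSet (V i))
    (hcap : ∀ i j, i ≠ j → V i ∩ V j ⊆ A ∪ pairOpen z₁ u ∪ (pairOpen z₁ z₂ ∪ pairOpen z₂ w)) :
    ∏ i, (prodBernoulli p).real (V i) ≤
      (prodBernoulli p).real (A ∪ pairOpen z₁ u ∪ (pairOpen z₁ z₂ ∪ pairOpen z₂ w)) ^ (n - 1) := by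
  have hu0 : IsUpperSet (secOff u A) := isUpperSet_secOff u hA
  have hu1 : IsUpperSet (secOn u A) := isUpperSet_secOn u hA
  have au0 : ∀ q, Safe q (secOff u A) := fun q => aSafe_delMinor hA hsafe u q
  have au1 : ∀ q, Safe q (secOn u A) := fun q => aSafe_conMinor hA hsafe u q
  exact leafLeaf_of_freeFour p h12 h1u h1w h2u h2w huw hd₁ hd₂ hA (aSafe_delMinor hu0 au0 w p) (aSafe_conMinor hu0 au0 w p)
    (aSafe_delMinor hu1 au1 w p) (aSafe_conMinor hu1 au1 w p) (au0 p) (au1 p) (aSafe_delMinor hA hsafe w p)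
    (aSafe_conMinor hA hsafe w p) (hsafe p) hF V hV hcap

/-- **Graph form: the core of `Γ₀ + z₁u + z₂w + z₁z₂` is safe at `p` under `FreeFour`.**  `z₁, z₂` isolated in `Γ₀`, `z₁, z₂, u, w`
pairwise distinct, `edgeCore Γ₀` A-safe, and `FreeFour` at the coins of `p` and the floors `μ_p(edgeCore Γ₀ | u = a, w = b)`. [this work] -/
theorem leafLeaf_of_freeFour_graph (Γ₀ : SimpleGraph ι) {z₁ z₂ u w : ι} (h12 : z₁ ≠ z₂) (h1u : z₁ ≠ u) (h1w : z₁ ≠ w)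
    (h2u : z₂ ≠ u) (h2w : z₂ ≠ w) (huw : u ≠ w) (hz₁ : ∀ x, ¬ Γ₀.Adj z₁ x) (hz₂ : ∀ x, ¬ Γ₀.Adj z₂ x)
    (hsafe : ∀ q : ι → unitInterval, Safe q (edgeCore Γ₀))
    (hF : FreeFour (p u) (p w) (p z₁) (p z₂)
      ((prodBernoulli p).real (secOff w (secOff u (edgeCore Γ₀)))) ((prodBernoulli p).real (secOn w (secOff u (edgeCore Γ₀))))
      ((prodBernoulli p).real (secOff w (secOn u (edgeCore Γ₀)))) ((prodBernoulli p).real (secOn w (secOn u (edgeCore Γ₀))))) :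
    Safe p (edgeCore (Γ₀ ⊔ SimpleGraph.fromEdgeSet {s(z₁, u)} ⊔ SimpleGraph.fromEdgeSet {s(z₂, w)} ⊔
      SimpleGraph.fromEdgeSet {s(z₁, z₂)})) := by
  classical
  have hcore : edgeCore (Γ₀ ⊔ SimpleGraph.fromEdgeSet {s(z₁, u)} ⊔ SimpleGraph.fromEdgeSet {s(z₂, w)} ⊔
      SimpleGraph.fromEdgeSet {s(z₁, z₂)}) = edgeCore Γ₀ ∪ pairOpen z₁ u ∪ (pairOpen z₁ z₂ ∪ pairOpen z₂ w) := by
    rw [edgeCore_sup_edge _ h12, edgeCore_sup_edge _ h2w, edgeCore_sup_edge _ h1u, Set.union_assoc _ (pairOpen z₂ w),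
      Set.union_comm (pairOpen z₂ w)]
  intro n V hV hcap
  rw [hcore] at hcap ⊢
  exact leafLeaf_of_freeFour_aSafe p h12 h1u h1w h2u h2w huw (determinedBy_edgeCore_of_isolated_one Γ₀ hz₁)
    (determinedBy_edgeCore_of_isolated_one Γ₀ hz₂) (isUpperSet_edgeCore Γ₀) hsafe hF V hV hcap

end SafeCalc

end Summit.CriticalPhenomena.PercolationContinuityZ3.Theorems.SunflowerPartition
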